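import Literature.MathematicalPhysics.QuantumFieldTheory.Balaban1983to89.B8SockH59CornerDefect
import Literature.MathematicalPhysics.QuantumFieldTheory.Balaban1983to89.B8LeafModelZd
import Literature.MathematicalPhysics.QuantumFieldTheory.Balaban1983to89.B8Prop6OfThm4
import Literature.MathematicalPhysics.QuantumFieldTheory.Balaban1983to89.B8Thm4Concrete

/-!
# `Balaban1983to89.B8SockH59NotAtCube` — KERNEL CERTIFICATE: the (1.59)-socket `B8LeafModelZd.SockH59` of the N05 knit is FALSE at the
# concrete cube member `{□_j}` of (1.131) (`cubeFam false ∕ cubeLamS ∕ cubeLamB`) — the named socket itself, for every `cP > 0`, `B₀ > 0`,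
# `B₀′ ≥ 0`, `d ≥ 2`, `1 ≤ L ≤ ρ`, `η > 0`, `k ≥ 1` (datum `(U₀, U′) = (1, 1)`, witness of `B8SockH59CornerDefect`)

statement-level skeleton of published theorems with citation tags; proofs where landed; nothing here is a claim about the
Yang–Mills mass gap

`[Balaban1985RegularSpaces]` ("B8", CMP **99** (1985) 75–102) (1.59) p. 86, Thm 4 p. 88, (1.33)–(1.35) p. 82, (1.66) p. 87, Prop. 6 p. 99, (1.131)
p. 99, p. 77; [4] = `[Balaban1985BackgroundPropagators]` Thm 3.3 p. 399.  PDF held: `paper:balaban1985-cmp99-regular-spaces-gauge-fixing`.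

CITATION HEADER (lean-in-tree rule).  Cell `pub-ymgap` (YM Track A, HUMAN RULING D-0062), DAG node N05 = [B8], seat `pub-ymgap-dag-n05-e` (g5;
director-ym R141 (C), FAN-OUT §N05 row s3b).  Third certificate of the located typing defect «(1.59) socket in the `SideTouches` currency at a
FINITE `Ω₀`» (`B8Ineq159FlatCornerDefect` — the scalar clause; `B8SockH59CornerDefect` — the `𝔸`-valued body at `(U₀, U′) = (1, 1)` and the
`H59₁` display).  HERE: the NAMED socket `B8LeafModelZd.SockH59` (n05-a; consumed by `B8Thm4Concrete.thm4Body_concrete_guarded` and fed in the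
knit by `B8LeafSocketsB9.sockH59_of_allLevels`) is refuted AT THE CUBE MEMBER: its outer quantifiers are met by `α₀ = α₁ = cP/2` and the trivial
datum `U₀ = U′ = 1` (in every class: `B8Prop6OfThm4.one_inAk`, `B8Eq119TwistedAxial.inAx_self`, averages equal), after which its body is the
`(1, 1)` body refuted by `B8SockH59CornerDefect.h59_body_false_of_corner` at `m = 1` (exponent constant `2L·5dLB₀(α₀+α₁) + 64B₀′·5dLB₀(α₀+α₁)
> 0`).  ★ `not_sockH59_cubeMember`.  CONSEQUENCE: every knit face that demands `SockH59` at the cube member `zdCub` (finite `□₀`) has an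
unsatisfiable socket there; the univ members (`Ω 0 = ℤᵈ`) are not hit.  Repair = the socket owner's (LHS over `BondTouches (Ω j)`, print's
p. 86 norm; or the family `cubeFam true`).

HONEST SCOPE.  A negative typing certificate; nothing of [4] ∕ [Balaban1985RegularSpaces] proved or refuted; count-neutral; N05 NOT discharged;
SECOND-GAP: none; one finite `T⁴` programme at fixed `ε`, Bałaban as printed; nothing continuum ∕ ℝ⁴ ∕ OS ∕ mass-gap ∕ Clay.  No `sorry`, no
`def`, no `instance`, no `notation`.  Unit `pub-ymgap-dag-n05-e` (g5), 2026-08-27.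
-/

noncomputable section

namespace Literature.MathematicalPhysics.QuantumFieldTheory.Balaban1983to89.B8SockH59NotAtCube

open NormedSpace
open B7Prop1Explicit (e)
open B7Prop2Explicit (unitaryUnits avgIter)
open B7Eq92Concrete (mgauge)
open B8Lemma1NonAbelian (mulCfg)
open B8Ineq132 (InAk)
open B8Eq119TwistedAxial (InAx Restr129 inAx_self)
open B7Prop1Local (InBox loK bondHiK)
open B8Eq140Level (SideTouches)
open B8LeafModelZd (SockH59)
open B8Eq131Cubes (sqLo sqHi bLo bHi gs one_le_gs cube)
open B8Eq131CubesAdmissible (cubeFam cubeFam_false_of_le)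
open B8CubeMemberZd (cubeLamS cubeLamB hbox_cubeLamB)
open B8Eq191FlatLettersCubeMember (cubeFam_subset_zero)
open B8Ineq130 (tlo thi tlo_zero thi_zero)
open B8SockHFPCubeMember (htw_cubeLamS)
open B8Prop6OfThm4 (one_inAk)
open B8Thm4Concrete (mulCfg_eq_mul)
open B8SockH59CornerDefect (h59_body_false_of_corner)

export B7Prop1Explicit (Site)

variable {d : ℕ}
variable {𝔸 : Type*} [CStarAlgebra 𝔸] [Nontrivial 𝔸]

/-- ★ **THE NAMED (1.59) SOCKET `SockH59` IS FALSE AT THE CONCRETE CUBE MEMBER `{□_j}` OF (1.131)** (`Ω := cubeFam false L a M ρ k`, towers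
`cubeLamS`, constraint bonds `cubeLamB`; `d ≥ 2`, `1 ≤ L ≤ ρ`, `η > 0`, `k ≥ 1`, every `cP > 0`, `B₀ > 0`, `B₀′ ≥ 0`).  PROOF: instantiate the
socket at `α₀ = α₁ = cP/2`, `U₀ = U′ = 1` (admissible: (1.33) `one_inAk` for `1 = mulCfg 1 1`, (1.34)-axial `inAx_self`, (1.35)∕(1.66) with
zero differences), and refute its body at `m = 1` by `B8SockH59CornerDefect.h59_body_false_of_corner` at the exposed corner `sqHi … 0` of
`□₀` (exponent constant `2L·c⋆ + 64B₀′c⋆`, `c⋆ = 5dLB₀cP > 0`). [cite: Balaban1985RegularSpaces, (1.59) p.86, Thm 4 p.88, (1.33)–(1.35) p.82, (1.66) p.87, Prop. 6 p.99, (1.131) p.99, p.77; Balaban1985BackgroundPropagators, Thm 3.3 p.399] -/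
theorem not_sockH59_cubeMember (hd2 : 2 ≤ d) {L : ℕ} (hL : 1 ≤ L) {η : ℝ} (hη : 0 < η) (a : Site d) (M : ℕ) {ρ : ℕ} (hρ : L ≤ ρ)
    {k : ℕ} (hk : 1 ≤ k) {B₀ B₀' cP : ℝ} (hB₀ : 0 < B₀) (hB₀' : 0 ≤ B₀') (hcP : 0 < cP) :
    ¬ SockH59 (𝔸 := 𝔸) L B₀ B₀' cP η k (cubeFam false L a M ρ k) (cubeLamS L a M ρ k) (cubeLamB L a M ρ k) := by
  intro H
  -- two directions and the exposed corner `hi` of `□₀`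
  obtain ⟨i₁, hi₁⟩ : ∃ i₁ : Fin d, i₁ = ⟨0, by omega⟩ := ⟨_, rfl⟩
  obtain ⟨i₂, hi₂⟩ : ∃ i₂ : Fin d, i₂ = ⟨1, by omega⟩ := ⟨_, rfl⟩
  have hne : i₁ ≠ i₂ := by rw [hi₁, hi₂]; exact fun h => absurd (Fin.mk.inj_iff.mp h) (by norm_num)
  have hΩ0 : (cubeFam false L a M ρ k) 0 = {x | InBox (sqLo L a ρ k 0) (sqHi L a M ρ k 0) x} := by
    rw [cubeFam_false_of_le L a M ρ (Nat.zero_le k)]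
    show cube L a M ρ k 0 = _
    simp only [cube, tlo_zero, thi_zero]
  have hgs := one_le_gs L k
  have hρ1 : 1 ≤ ρ := hL.trans hρ
  have hc : sqHi L a M ρ k 0 ∈ (cubeFam false L a M ρ k) 0 := by
    rw [hΩ0]
    intro i
    refine ⟨?_, le_rfl⟩
    simp only [sqLo, sqHi, bLo, bHi, Nat.sub_zero]
    have h1 : (1 : ℤ) ≤ (ρ : ℤ) * (gs L k : ℤ) := by
      have : (1 : ℤ) ≤ ρ := by exact_mod_cast hρ1
      have : (1 : ℤ) ≤ gs L k := by exact_mod_cast hgs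
      nlinarith
    have h2 : (0 : ℤ) ≤ (L : ℤ) ^ k * M := by positivity
    push_cast
    nlinarith
  have hmax : ∀ x ∈ (cubeFam false L a M ρ k) 0, x i₁ ≤ sqHi L a M ρ k 0 i₁ ∧ x i₂ ≤ sqHi L a M ρ k 0 i₂ := by
    intro x hx
    rw [hΩ0] at hx
    exact ⟨(hx i₁).2, (hx i₂).2⟩
  -- the trivial datum `(U₀, U′) = (1, 1)` at `α₀ = α₁ = cP/2`
  have hα : 0 < cP / 2 := by positivity
  have h1u : ∀ (x : Site d) (κ : Fin d), (1 : Site d → Fin d → 𝔸ˣ) x κ ∈ unitaryUnits 𝔸 := fun _ _ => (unitaryUnits 𝔸).one_mem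
  have hmul : mulCfg (1 : Site d → Fin d → 𝔸ˣ) (1 : Site d → Fin d → 𝔸ˣ) = 1 := by rw [mulCfg_eq_mul, mul_one]
  have hA : InAk L k η (cP / 2) (cubeFam false L a M ρ k) (1 : Site d → Fin d → 𝔸ˣ) := one_inAk hL k hη hα _
  have hA' : InAk L k η (cP / 2) (cubeFam false L a M ρ k) (mulCfg (1 : Site d → Fin d → 𝔸ˣ) 1) := by rw [hmul]; exact hA
  have hAx : ∀ m, m ≤ k → InAx L m (cubeLamS L a M ρ k m) (1 : Site d → Fin d → 𝔸ˣ) (mulCfg (1 : Site d → Fin d → 𝔸ˣ) 1) :=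
    fun m _ => by rw [hmul]; exact inAx_self L m _ _
  have h135 : ∀ j, j ≤ k → ∀ (z : Site d) (μ : Fin d), (∀ x, InBox (loK L j z) (bondHiK L j z μ) x → x ∈ cubeFam false L a M ρ k j) →
      ‖(avgIter L (mulCfg (1 : Site d → Fin d → 𝔸ˣ) 1) j z μ : 𝔸) - (avgIter L (1 : Site d → Fin d → 𝔸ˣ) j z μ : 𝔸)‖ ≤ cP / 2 := by
    intro j _ z μ _
    rw [hmul, sub_self, norm_zero]; exact hα.le
  have h66 : ∀ b ∈ {b : Site d × Fin d | SideTouches (cubeFam false L a M ρ k 0) b.1 b.2},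
      ‖(((1 : Site d → Fin d → 𝔸ˣ) b.1 b.2 : 𝔸ˣ) : 𝔸) - 1‖ ≤ cP / 2 := by
    intro b _
    rw [Pi.one_apply, Pi.one_apply, Units.val_one, sub_self, norm_zero]; exact hα.le
  have body := H (cP / 2) (cP / 2) hα hα (by linarith) 1 1 h1u h1u hA hA' hAx h135 h66 1 le_rfl hk
  -- the exponent constant is positive
  have hcst : 0 < 2 * (L * (5 * (d : ℝ) * L * B₀ * (cP / 2 + cP / 2))) + 8 * (8 * B₀' * (5 * (d : ℝ) * L * B₀) * (cP / 2 + cP / 2)) := by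
    have hL0 : (0 : ℝ) < L := by exact_mod_cast hL
    have hd0 : (0 : ℝ) < d := by exact_mod_cast (lt_of_lt_of_le (by norm_num) hd2)
    have h1 : 0 < 2 * (L * (5 * (d : ℝ) * L * B₀ * (cP / 2 + cP / 2))) := by positivity
    have h2 : 0 ≤ 8 * (8 * B₀' * (5 * (d : ℝ) * L * B₀) * (cP / 2 + cP / 2)) := by positivity
    linarith
  exact h59_body_false_of_corner hne hL hη 1 (cubeFam false L a M ρ k) (cubeLamS L a M ρ k 1) (cubeLamB L a M ρ k 1) B₀ hcst
    (sqHi L a M ρ k 0) hc hmax (fun j _ => cubeFam_subset_zero hL a M hρ k j)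
    (fun j hj q hq x hx => cubeFam_subset_zero hL a M hρ k j (hbox_cubeLamB L a M ρ k 1 hk j hj q hq x hx))
    (fun j hj y hy x hx => cubeFam_subset_zero hL a M hρ k j (htw_cubeLamS hL a M ρ k 1 hk j hj y hy x hx)) body

#print axioms not_sockH59_cubeMember

end Literature.MathematicalPhysics.QuantumFieldTheory.Balaban1983to89.B8SockH59NotAtCube

end
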